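import Mathlib
import HarnessLib
import Summits.Ventures.LatticeQCDFlow.Exactness.U1JitteredHMCAtomless
import Summits.Ventures.LatticeQCDFlow.Exactness.U1WilsonForceLipschitz
import Summits.Ventures.LatticeQCDFlow.Exactness.UniformJitterLaw

/-!
# The `u1_2d` engine's HMC AS RUN with `tau_jitter`: the code's uniform law of the length, the Wilson force field as increment — exact for every `(n, τ, j)`; ONE Doeblin certificate, convergence from every start and the `τ_int` bound whenever `τ(1 − j) < τ₀(d, c)`, in particular for `j = 1` at EVERY `τ`

HONEST FRAMING: exact (Metropolis-corrected) sampling algorithms for lattice gauge theory;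
figures of merit are autocorrelation/cost numbers at stated couplings and volumes; no
continuum-physics claim.

Venture `LatticeQCDFlow` (cell pub-lqcd), topic `Exactness`, FANOUT row 9 (eng-latcore, GEN-25; item (R3) of the
GEN-24 HANDOFF).  The engine (`latflow.core.u1_2d.U1Field2D.hmc_trajectory(β, τ, nstep, tau_jitter)`, 0.2.1+):
`tau_t = tau * (1 + tau_jitter * (2u − 1))`, `u ∼ U(0,1)` drawn before and independently of the state, `dt = tau_t/nstep`,
`nstep` P-first leapfrog steps with the momentum increment `dt · (Wilson force field)`.  NEW WORK of the cell composing
GEN-24's `U1JitteredHMCAtomless.lean` (`u1JitterHMCL`: the labelled `U(1)` kernel for ANY law of the step, exact /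
reversible for every law; `wilson_u1JitterHMCL_certificate` / `_uniformlyErgodic` / `_tauInt_setACF_le` whenever the law
of the STEP charges a short window `[ε₁, ε₂]` on which the increments are `K`-Lipschitz with `4Kε₂n² ≤ 3`),
`UniformJitterLaw.lean` (`uniformJitterLaw τ j`, `uniformJitterLaw_charges_short`) and `U1WilsonForceLipschitz.lean`
(the engine's increment `a · Z`: `8(d−1)|a|`-Lipschitz, bounded by `2(d−1)|a|`).  Nothing is cited as a fact; no number is
claimed (the threshold below is a closed form in `d` and the increment coefficient `c`, never evaluated).

## Content

* §1 **`uniformJitterLaw_map_div`** — the law of the STEP under `tau_jitter`: `(uniformJitterLaw τ j).map (· / r) =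
  uniformJitterLaw (τ / r) j` — the step `tau_t / nstep` is again of the code's form, with `τ/nstep` in place of `τ`.
* §2 **`u1EngineIncrement c`** (def) — the engine's momentum-increment family indexed by the step,
  `g_ε(V)_e = (c ε) · Z_e(V)` (`Z` = the leading-order Wilson-flow field of `U1WilsonForceLipschitz`; the code's
  coefficient `c` is a fixed real, any value covered); jointly measurable in `(ε, V)`, `8(d−1)|cε|`-Lipschitz, bounded by
  `2(d−1)|cε|`.  **`u1UniformJitterHMC ρ β c κ n τ j`** (def) — THE `u1_2d` ENGINE'S JITTERED HMC AS RUN: the labelled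
  kernel at the label law `uniformJitterLaw (τ/n) j` of the step; Markov.
* §3 **`wilson_u1UniformJitterHMC_invariant`** / **`_isReversible`** — EXACT and in detailed balance w.r.t.
  `wilsonMeasure ρ β` for EVERY `n`, `τ`, `j`, `c`, `κ > 0`.
* §4 **`u1EngineTrajThreshold d c := 1 / (32 (d−1) |c| + 1)`** (def, `> 0`); **`wilson_u1UniformJitterHMC_certificate`** —
  for every `κ > 0`, `n ≥ 1`, `τ > 0`, `0 < j ≤ 1` with `τ(1 − j) < u1EngineTrajThreshold d c`: ONE `0 < ε' ≤ 1` with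
  `ε' • Haar^{⊗E} ≤ K(U, ·)` for EVERY configuration `U`; **`wilson_u1UniformJitterHMC_uniformlyErgodic`** — geometric
  convergence in total variation from EVERY initial law + uniqueness of the invariant law;
  **`wilson_u1UniformJitterHMC_tauInt_setACF_le`** — `τ_int(1_A) ≤ 1/2 + B/(1 − π(A))` for every event;
  **`wilson_u1FullJitterHMC_uniformlyErgodic`** — `j = 1`: convergence from every start for EVERY `τ > 0`, `n ≥ 1`.

NOT CLAIMED: anything for `τ(1 − j) ≥ τ₀` (every drawn step long); any value of the constants `ε'`, `r`, `B` (they carry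
the window mass of the step law below the threshold); that the code's coefficient has a particular sign or value (every
real `c` is covered); that jitter improves any autocorrelation; floating point (the code's `u` is a 53-bit uniform).
-/

noncomputable section

namespace Summit.Ventures.LatticeQCDFlow.Exactness

open MeasureTheory ProbabilityTheory ProbabilityTheory.Kernel Set Metric Function
open Literature.MathematicalPhysics.QuantumFieldTheory
open scoped ENNReal NNReal

set_option backward.isDefEq.respectTransparency false

/-! ## §1 The law of the step -/

section StepLaw

/-- **THE LAW OF THE STEP UNDER `tau_jitter`**: dividing the drawn length by `r` gives the code's law with `τ/r` in place
of `τ` (`dt = tau_t / nstep`). -/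
theorem uniformJitterLaw_map_div (τ j r : ℝ) :
    (uniformJitterLaw τ j).map (fun t : ℝ => t / r) = uniformJitterLaw (τ / r) j := by
  have hm : Measurable fun t : ℝ => t / r := measurable_id.div_const r
  rw [uniformJitterLaw, uniformJitterLaw, Measure.map_map hm (measurable_jitterFormula τ j)]
  congr 1
  funext u
  simp only [Function.comp_apply]
  ring

end StepLaw

/-! ## §2 The engine's increment family and the jittered kernel as run -/

section Engine

variable {d L : ℕ}

/-- **THE `u1_2d` ENGINE'S MOMENTUM-INCREMENT FAMILY INDEXED BY THE STEP**: `g_ε(V)_e = (c ε) · Z_e(V)` with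
`Z_e(V) = Σ_{ν ≠ μ(e)} (Im P_{x−ν̂; μν} − Im P_{x; μν})` the leading-order Wilson-flow field (`c` = the code's fixed
coefficient). -/
def u1EngineIncrement [NeZero L] (c : ℝ) : ℝ → GaugeConfig d L Circle → Edge d L → ℝ :=
  fun ε V e => c * ε * ∑ ν ∈ Finset.univ.erase e.2,
    ((((plaquetteHolonomy V (e.1 - Pi.single ν 1) e.2 ν : Circle) : ℂ).im -
      ((plaquetteHolonomy V e.1 e.2 ν : Circle) : ℂ).im))

variable [NeZero L]

/-- Each member is `8(d−1)|cε|`-Lipschitz (chordal sup metric). -/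
theorem lipschitzWith_u1EngineIncrement (c ε : ℝ) :
    LipschitzWith (Real.toNNReal (8 * ((d - 1 : ℕ) : ℝ) * |c * ε|)) (u1EngineIncrement (d := d) (L := L) c ε) :=
  lipschitzWith_smul_u1FlowField (d := d) (L := L) (c * ε)

/-- Each member is bounded link by link by `2(d−1)|cε|`. -/
theorem norm_u1EngineIncrement_le (c ε : ℝ) (V : GaugeConfig d L Circle) (e : Edge d L) :
    ‖u1EngineIncrement c ε V e‖ ≤ 2 * ((d - 1 : ℕ) : ℝ) * |c * ε| :=
  norm_smul_u1FlowField_apply_le (d := d) (L := L) (c * ε) V e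

/-- Each member is continuous. -/
theorem continuous_u1EngineIncrement (c ε : ℝ) : Continuous (u1EngineIncrement (d := d) (L := L) c ε) :=
  (lipschitzWith_u1EngineIncrement c ε).continuous

/-- **THE FAMILY IS JOINTLY MEASURABLE IN `(ε, V)`** (it is jointly continuous: affine in `ε`, Lipschitz in `V`). -/
theorem measurable_uncurry_u1EngineIncrement (c : ℝ) :
    Measurable fun q : ℝ × GaugeConfig d L Circle => u1EngineIncrement c q.1 q.2 := by
  have h1 : Continuous (u1EngineIncrement (d := d) (L := L) c 1) := continuous_u1EngineIncrement c 1
  have hcoord : ∀ e : Edge d L, Continuous fun V : GaugeConfig d L Circle => u1EngineIncrement c 1 V e :=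
    fun e => (continuous_apply e).comp h1
  have heq : (fun q : ℝ × GaugeConfig d L Circle => u1EngineIncrement c q.1 q.2) =
      fun q => fun e => q.1 * u1EngineIncrement c 1 q.2 e := by
    funext q e
    simp only [u1EngineIncrement, mul_one]
    ring
  rw [heq]
  haveI : OpensMeasurableSpace (ℝ × GaugeConfig d L Circle) := Prod.opensMeasurableSpace
  exact (continuous_pi fun e => continuous_fst.mul ((hcoord e).comp continuous_snd)).measurable

variable {N : ℕ} (ρ : Circle →* Matrix (Fin N) (Fin N) ℂ)

/-- **THE `u1_2d` ENGINE'S JITTERED HMC AS RUN** (`hmc_trajectory(β, τ, nstep = n, tau_jitter = j)` read through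
`θ ↦ e^{iθ}`): refresh Gaussian momenta (`κ`), draw the step `ε ∼ uniformJitterLaw (τ/n) j` independently of the state,
run `n` P-first leapfrog steps with increment `g_ε = (cε) · Z`, flip, Metropolis test on `β S_W + T_κ`, forget. -/
def u1UniformJitterHMC (β c κ : ℝ) (n : ℕ) (τ j : ℝ) :
    Kernel (GaugeConfig d L Circle) (GaugeConfig d L Circle) :=
  u1JitterHMCL (Lab := ℝ) measurable_id (g := u1EngineIncrement c) (measurable_uncurry_u1EngineIncrement c) κ
    (fun U : GaugeConfig d L Circle => β * wilsonAction ρ U) (N := fun _ => n) measurable_const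
    (uniformJitterLaw (τ / n) j)

/-- The kernel is Markov (`κ > 0`, continuous `ρ`). -/
theorem isMarkovKernel_u1UniformJitterHMC (hρ : Continuous ρ) (β c : ℝ) {κ : ℝ} (hκ : 0 < κ) (n : ℕ) (τ j : ℝ) :
    IsMarkovKernel (u1UniformJitterHMC (d := d) (L := L) ρ β c κ n τ j) :=
  isMarkovKernel_u1JitterHMCL (hε := measurable_id) (hg := measurable_uncurry_u1EngineIncrement c)
    (N := fun _ => n) (hN := measurable_const) (η := uniformJitterLaw (τ / n) j) hκ
    (continuous_smul_wilsonAction ρ hρ β).measurable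

end Engine

/-! ## §3 Exact and reversible for every `(n, τ, j)` -/

section Exact

variable {d L N : ℕ} [NeZero L] (ρ : Circle →* Matrix (Fin N) (Fin N) ℂ)

/-- **EXACT FOR EVERY `n`, `τ`, `j`, `c`, `κ > 0`**: the engine's jittered `U(1)` HMC as run leaves `wilsonMeasure ρ β`
invariant. -/
theorem wilson_u1UniformJitterHMC_invariant (hρ : Continuous ρ) (β c : ℝ) {κ : ℝ} (hκ : 0 < κ) (n : ℕ) (τ j : ℝ) :
    Kernel.Invariant (u1UniformJitterHMC ρ β c κ n τ j) (wilsonMeasure (d := d) (L := L) ρ β) :=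
  wilson_u1JitterHMCL_invariant ρ hρ β hκ n (measurable_uncurry_u1EngineIncrement c) _

/-- **DETAILED BALANCE FOR EVERY `n`, `τ`, `j`, `c`, `κ`** w.r.t. `wilsonMeasure ρ β`. -/
theorem wilson_u1UniformJitterHMC_isReversible (hρ : Continuous ρ) (β c κ : ℝ) (n : ℕ) (τ j : ℝ) :
    IsReversible (u1UniformJitterHMC ρ β c κ n τ j) (wilsonMeasure (d := d) (L := L) ρ β) :=
  wilson_u1JitterHMCL_isReversible ρ hρ β κ n (measurable_uncurry_u1EngineIncrement c) _

end Exact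

/-! ## §4 The short-trajectory threshold: certificate, convergence from every start, `τ_int` -/

section Threshold

/-- **THE TRAJECTORY-LENGTH THRESHOLD OF THE `u1_2d` ENGINE'S HMC**: `τ₀(d, c) = 1 / (32 (d−1) |c| + 1)` — chosen so that
`32 (d−1) |c| τ₀² ≤ 3`, i.e. every step `ε ≤ τ₀/n` satisfies the short-trajectory condition `4 K_ε ε n² ≤ 3` of the
`U(1)` leapfrog minorant with `K_ε = 8(d−1)|c|ε`. -/
def u1EngineTrajThreshold (d : ℕ) (c : ℝ) : ℝ := 1 / (32 * ((d - 1 : ℕ) : ℝ) * |c| + 1)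

/-- The threshold is positive. -/
theorem u1EngineTrajThreshold_pos (d : ℕ) (c : ℝ) : 0 < u1EngineTrajThreshold d c := by
  unfold u1EngineTrajThreshold; positivity

/-- The defining inequality of the threshold: `32 (d−1) |c| τ₀² ≤ 3`. -/
theorem u1EngineTrajThreshold_sq_le (d : ℕ) (c : ℝ) :
    32 * ((d - 1 : ℕ) : ℝ) * |c| * u1EngineTrajThreshold d c ^ 2 ≤ 3 := by
  set A : ℝ := 32 * ((d - 1 : ℕ) : ℝ) * |c| with hA
  have hA0 : 0 ≤ A := by positivity
  have hA1 : 0 < A + 1 := by positivity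
  unfold u1EngineTrajThreshold
  rw [← hA, div_pow, one_pow, ← div_eq_mul_one_div, div_le_iff₀ (by positivity)]
  nlinarith

/-- The arithmetic of the window `[ε₁, ε₂] ⊂ (0, τ₀/n]`: with `K = 8(d−1)|c|τ₀/n` one has `4 K ε₂ n² ≤ 3`. -/
theorem u1Engine_window_short (d : ℕ) (c : ℝ) {n : ℕ} (hn : 1 ≤ n) {ε₂ : ℝ}
    (h2 : ε₂ ≤ u1EngineTrajThreshold d c / n) :
    4 * (8 * ((d - 1 : ℕ) : ℝ) * |c| * (u1EngineTrajThreshold d c / n)) * ε₂ * (n : ℝ) ^ 2 ≤ 3 := by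
  have hn' : (0 : ℝ) < n := by exact_mod_cast hn
  have hK0 : 0 ≤ 8 * ((d - 1 : ℕ) : ℝ) * |c| * (u1EngineTrajThreshold d c / n) := by
    have := (u1EngineTrajThreshold_pos d c).le; positivity
  calc 4 * (8 * ((d - 1 : ℕ) : ℝ) * |c| * (u1EngineTrajThreshold d c / n)) * ε₂ * (n : ℝ) ^ 2
      ≤ 4 * (8 * ((d - 1 : ℕ) : ℝ) * |c| * (u1EngineTrajThreshold d c / n)) * (u1EngineTrajThreshold d c / n) *
          (n : ℝ) ^ 2 := by gcongr
    _ = 32 * ((d - 1 : ℕ) : ℝ) * |c| * u1EngineTrajThreshold d c ^ 2 := by field_simp; ring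
    _ ≤ 3 := u1EngineTrajThreshold_sq_le d c

variable {d L N : ℕ} [NeZero L] (ρ : Circle →* Matrix (Fin N) (Fin N) ℂ)

/-- **THE WINDOW OF THE STEP LAW BELOW THE THRESHOLD** (`n ≥ 1`, `τ > 0`, `0 < j ≤ 1`, `τ(1 − j) < τ₀(d, c)`): the law
`uniformJitterLaw (τ/n) j` of the step charges a window `[ε₁, ε₂] ⊂ (0, τ₀/n]` on which every increment `g_ε` is
`K`-Lipschitz with ONE `K = 8(d−1)|c|τ₀/n` satisfying `4 K ε₂ n² ≤ 3`, and bounded by ONE `b = 2(d−1)|c|τ₀/n`. -/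
theorem u1Engine_window (c : ℝ) {n : ℕ} (hn : 1 ≤ n) {τ j : ℝ} (hτ : 0 < τ) (hj : 0 < j) (hj1 : j ≤ 1)
    (hshort : τ * (1 - j) < u1EngineTrajThreshold d c) :
    ∃ ε₁ ε₂ : ℝ, 0 < ε₁ ∧ ε₁ ≤ ε₂ ∧
      (∀ ε ∈ Icc ε₁ ε₂, LipschitzWith (Real.toNNReal (8 * ((d - 1 : ℕ) : ℝ) * |c| * (u1EngineTrajThreshold d c / n)))
        (u1EngineIncrement (d := d) (L := L) c ε)) ∧
      4 * ((Real.toNNReal (8 * ((d - 1 : ℕ) : ℝ) * |c| * (u1EngineTrajThreshold d c / n)) : ℝ≥0) : ℝ) * ε₂ *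
          (n : ℝ) ^ 2 ≤ 3 ∧
      (∀ ε ∈ Icc ε₁ ε₂, ∀ (U : GaugeConfig d L Circle) (e : Edge d L),
        ‖u1EngineIncrement c ε U e‖ ≤ 2 * ((d - 1 : ℕ) : ℝ) * |c| * (u1EngineTrajThreshold d c / n)) ∧
      uniformJitterLaw (τ / n) j (Icc ε₁ ε₂) ≠ 0 := by
  have hn' : (0 : ℝ) < n := by exact_mod_cast hn
  set τ₀ := u1EngineTrajThreshold d c with hτ₀
  have hτ₀0 : 0 < τ₀ := u1EngineTrajThreshold_pos d c
  -- the law of the STEP charges a window `[ε₁, ε₂] ⊂ (0, τ₀/n]`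
  have hstep : τ / n * (1 - j) < τ₀ / n := by
    rw [div_mul_eq_mul_div]; exact div_lt_div_of_pos_right hshort hn'
  obtain ⟨ε₁, ε₂, hε₁, h12, h2, hη⟩ := uniformJitterLaw_charges_short (div_pos hτ hn') hj hj1 hstep
  refine ⟨ε₁, ε₂, hε₁, h12, fun ε hε => ?_, ?_, fun ε hε U e => ?_, hη⟩
  · refine (lipschitzWith_u1EngineIncrement c ε).weaken (Real.toNNReal_le_toNNReal ?_)
    rw [abs_mul, abs_of_pos (hε₁.trans_le hε.1), ← mul_assoc]
    exact mul_le_mul_of_nonneg_left (hε.2.trans h2) (by positivity)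
  · rw [Real.coe_toNNReal _ (by positivity)]
    exact u1Engine_window_short d c hn h2
  · refine (norm_u1EngineIncrement_le c ε U e).trans ?_
    rw [abs_mul, abs_of_pos (hε₁.trans_le hε.1), ← mul_assoc]
    exact mul_le_mul_of_nonneg_left (hε.2.trans h2) (by positivity)

/-- **ONE DOEBLIN CERTIFICATE OF THE ENGINE'S JITTERED `U(1)` HMC WHENEVER `τ(1 − j) < τ₀(d, c)`** (`κ > 0`, `n ≥ 1`,
`τ > 0`, `0 < j ≤ 1`): the kernel is exact and ONE `0 < ε' ≤ 1` gives `ε' • Haar^{⊗E} ≤ K(U, ·)` for EVERY configuration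
`U`.  (The law of the step charges a window below `τ₀/n`, on which every increment is `K`-Lipschitz with `4Kε₂n² ≤ 3`.) -/
theorem wilson_u1UniformJitterHMC_certificate (hρ : Continuous ρ) (β c : ℝ) {κ : ℝ} (hκ : 0 < κ) {n : ℕ} (hn : 1 ≤ n)
    {τ j : ℝ} (hτ : 0 < τ) (hj : 0 < j) (hj1 : j ≤ 1) (hshort : τ * (1 - j) < u1EngineTrajThreshold d c) :
    Kernel.Invariant (u1UniformJitterHMC ρ β c κ n τ j) (wilsonMeasure (d := d) (L := L) ρ β) ∧
      ∃ ε' : ℝ≥0∞, 0 < ε' ∧ ε' ≤ 1 ∧ ∀ U : GaugeConfig d L Circle,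
        ε' • Measure.pi (fun _ : Edge d L => haarProbability Circle) ≤ u1UniformJitterHMC ρ β c κ n τ j U := by
  obtain ⟨ε₁, ε₂, hε₁, h12, hK, hshort', hb, hη⟩ := u1Engine_window (d := d) (L := L) c hn hτ hj hj1 hshort
  exact wilson_u1JitterHMCL_certificate ρ hρ β hε₁ h12 hκ hn (measurable_uncurry_u1EngineIncrement c) hK hshort'
    (by have := (u1EngineTrajThreshold_pos d c).le; positivity) hb (uniformJitterLaw (τ / n) j) hη

/-- **CONVERGENCE FROM EVERY START + UNIQUENESS WHENEVER `τ(1 − j) < τ₀(d, c)`** (same hypotheses): some `0 < r ≤ 1`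
with `|μ₀ Kᵗ(A) − π(A)| ≤ (1 − r)^t` for EVERY initial law `μ₀`, every `t`, every `A`, `π = wilsonMeasure ρ β`, and `π` is
the unique invariant probability law. -/
theorem wilson_u1UniformJitterHMC_uniformlyErgodic (hρ : Continuous ρ) (β c : ℝ) {κ : ℝ} (hκ : 0 < κ) {n : ℕ}
    (hn : 1 ≤ n) {τ j : ℝ} (hτ : 0 < τ) (hj : 0 < j) (hj1 : j ≤ 1) (hshort : τ * (1 - j) < u1EngineTrajThreshold d c) :
    ∃ r : ℝ, 0 < r ∧ r ≤ 1 ∧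
      (∀ (μ₀ : Measure (GaugeConfig d L Circle)) [IsProbabilityMeasure μ₀] (t : ℕ) (A : Set (GaugeConfig d L Circle)),
        |((fun m : Measure (GaugeConfig d L Circle) => m.bind (u1UniformJitterHMC ρ β c κ n τ j))^[t] μ₀).real A -
            (wilsonMeasure (d := d) (L := L) ρ β).real A| ≤ (1 - r) ^ t) ∧
      ∀ (π' : Measure (GaugeConfig d L Circle)) [IsProbabilityMeasure π'],
        Kernel.Invariant (u1UniformJitterHMC ρ β c κ n τ j) π' → π' = wilsonMeasure (d := d) (L := L) ρ β := by
  obtain ⟨ε₁, ε₂, hε₁, h12, hK, hshort', hb, hη⟩ := u1Engine_window (d := d) (L := L) c hn hτ hj hj1 hshort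
  exact wilson_u1JitterHMCL_uniformlyErgodic ρ hρ β hε₁ h12 hκ hn (measurable_uncurry_u1EngineIncrement c) hK hshort'
    (by have := (u1EngineTrajThreshold_pos d c).le; positivity) hb (uniformJitterLaw (τ / n) j) hη

/-- **THE `τ_int` BOUND OF EVERY EVENT WHENEVER `τ(1 − j) < τ₀(d, c)`** (same hypotheses): some `B ≥ 0` with
`τ_int(1_A) ≤ 1/2 + B/(1 − π(A))` for every measurable `A` with `0 < π(A) < 1`, `π = wilsonMeasure ρ β`. -/
theorem wilson_u1UniformJitterHMC_tauInt_setACF_le (hρ : Continuous ρ) (β c : ℝ) {κ : ℝ} (hκ : 0 < κ) {n : ℕ}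
    (hn : 1 ≤ n) {τ j : ℝ} (hτ : 0 < τ) (hj : 0 < j) (hj1 : j ≤ 1) (hshort : τ * (1 - j) < u1EngineTrajThreshold d c) :
    ∃ B : ℝ, 0 ≤ B ∧ ∀ A : Set (GaugeConfig d L Circle), MeasurableSet A →
      0 < (wilsonMeasure (d := d) (L := L) ρ β).real A → (wilsonMeasure (d := d) (L := L) ρ β).real A < 1 →
      Scoring.tauInt (setACF (u1UniformJitterHMC ρ β c κ n τ j) (wilsonMeasure (d := d) (L := L) ρ β) A) ≤
        1 / 2 + B / (1 - (wilsonMeasure (d := d) (L := L) ρ β).real A) := by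
  obtain ⟨ε₁, ε₂, hε₁, h12, hK, hshort', hb, hη⟩ := u1Engine_window (d := d) (L := L) c hn hτ hj hj1 hshort
  exact wilson_u1JitterHMCL_tauInt_setACF_le ρ hρ β hε₁ h12 hκ hn (measurable_uncurry_u1EngineIncrement c) hK hshort'
    (by have := (u1EngineTrajThreshold_pos d c).le; positivity) hb (uniformJitterLaw (τ / n) j) hη

/-- **`tau_jitter = 1`: CONVERGENCE FROM EVERY START FOR EVERY PRODUCTION LENGTH** — for `j = 1` the condition
`τ(1 − j) < τ₀` holds at EVERY `τ > 0`, so for every `n ≥ 1`, `κ > 0`, `c`, the engine's fully jittered `U(1)` HMC converges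
to the Wilson measure geometrically in total variation from every initial law, with a unique invariant law. -/
theorem wilson_u1FullJitterHMC_uniformlyErgodic (hρ : Continuous ρ) (β c : ℝ) {κ : ℝ} (hκ : 0 < κ) {n : ℕ}
    (hn : 1 ≤ n) {τ : ℝ} (hτ : 0 < τ) :
    ∃ r : ℝ, 0 < r ∧ r ≤ 1 ∧
      (∀ (μ₀ : Measure (GaugeConfig d L Circle)) [IsProbabilityMeasure μ₀] (t : ℕ) (A : Set (GaugeConfig d L Circle)),
        |((fun m : Measure (GaugeConfig d L Circle) => m.bind (u1UniformJitterHMC ρ β c κ n τ 1))^[t] μ₀).real A -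
            (wilsonMeasure (d := d) (L := L) ρ β).real A| ≤ (1 - r) ^ t) ∧
      ∀ (π' : Measure (GaugeConfig d L Circle)) [IsProbabilityMeasure π'],
        Kernel.Invariant (u1UniformJitterHMC ρ β c κ n τ 1) π' → π' = wilsonMeasure (d := d) (L := L) ρ β :=
  wilson_u1UniformJitterHMC_uniformlyErgodic ρ hρ β c hκ hn hτ one_pos le_rfl
    (by rw [sub_self, mul_zero]; exact u1EngineTrajThreshold_pos d c)

end Threshold

end Summit.Ventures.LatticeQCDFlow.Exactness

end
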